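import Literature.Geometry.Riemannian.NonTrappingConvexSublevelProofs
import Literature.Geometry.Riemannian.ExitTime
import Literature.Geometry.Lorentzian.CurvatureProofs
import Literature.Geometry.Lorentzian.CurvatureSymmetries
import HarnessLib

/-!
# Short geodesics in a strictly convex sublevel domain (Paternain–Salo–Uhlmann 2023, §3.1)

Towards `PaternainSaloUhlmann2023_contractible_sublevel` (Prop. 3.7.22) by Birkhoff curve
shortening: the local geodesic convexity of a strictly convex sublevel domain `D = {ρ ≤ 0}`
(`IsStrictlyConvexSublevel g ρ`, `NonTrappingConvexSublevel.lean`) of a compact Riemannian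
manifold.

* `continuous_hessian_tangentBundle` — the Hessian quadratic form `(x, v) ↦ Hess_x ρ(v, v)` of a
  `C²` function is continuous on `TM` (O'Neill 1983, Ch. 3, Def. 3.48–Lemma 3.49: in a local frame
  `sᵢ`, `Hess ρ(sᵢ, sⱼ) = sᵢ(sⱼ ρ) - (∇_{sᵢ} sⱼ)ρ` are continuous functions; `hessian_apply_holds`,
  Mathlib's local frames `Trivialization.localFrame`, the local regularity of the Levi-Civita
  connection `isLocallyContMDiff_leviCivita_holds`).
* `exists_abs_mvfderiv_le_mul_sqrt` — `|dρ(v)| ≤ C |v|_g` on a compact manifold.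
* `IsStrictlyConvexSublevel.exists_pos_forall_abs_le` — **strict convexity persists on the nearby
  level sets**: `δ > 0` with `dρ ≠ 0` and `Hess ρ > 0` on `ker dρ ∖ 0` along `{|ρ| ≤ δ}`
  (compactness of the unit sphere bundle).
* `IsStrictlyConvexSublevel.exists_pos_forall_isGeodesic` — **short geodesics with endpoints in
  `D` (resp. in its interior) stay in `D` (resp. in its interior)**: there is `ℓ₀ > 0` such that a
  geodesic of speed `< ℓ₀` with `ρ ≤ 0` (resp. `< 0`) at `t = 0, 1` has `ρ ≤ 0` (resp. `< 0`) on
  `[0, 1]` — PSU Lemma 3.1.12 (`(ρ ∘ γ)'' = Hess ρ(γ', γ')` along geodesics, the tree's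
  `hasDerivAt_mvfderiv_velocity_of_isGeodesicOn`) at an interior maximum of `ρ ∘ γ`.

No definitions, no named facts (D-0026).

## References

* G. P. Paternain, M. Salo, G. Uhlmann, *Geometric inverse problems, with emphasis on two
  dimensions*, CUP 2023: Def. 3.1.7, Lemma 3.1.12, Prop. 3.7.22. [PaternainSaloUhlmann2023]
* B. O'Neill, *Semi-Riemannian geometry*, Academic Press 1983, Ch. 3, Def. 3.48–Lemma 3.49.
  [ONeill1983]
-/

noncomputable section

open Bundle Set Filter Function Manifold
open scoped Manifold ContDiff Topology ENNReal

namespace Literature.Geometry.Riemannian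

open Literature.Geometry.Lorentzian
open Literature.Geometry.Lorentzian.PseudoRiemannianMetric

variable {E : Type*} [NormedAddCommGroup E] [NormedSpace ℝ E] {H : Type*} [TopologicalSpace H]
  {I : ModelWithCorners ℝ E H} {M : Type*} [TopologicalSpace M] [ChartedSpace H M]
  [IsManifold I ∞ M] {n : ℕ∞ω} [FiniteDimensional ℝ E] [CompleteSpace E]
  (g : PseudoRiemannianMetric I n E (TangentSpace I : M → Type _)) [Fact (1 ≤ n)] [g.HasLeviCivita]

/-! ### Continuity of the Hessian quadratic form on the tangent bundle -/

/-- **The Hessian quadratic form `(x, v) ↦ Hess_x ρ (v, v)` is continuous on `TM`** for `ρ` of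
class `C²` (O'Neill 1983, Ch. 3, Def. 3.48–Lemma 3.49: `H^ρ(X, Y) = X(Yρ) - (∇_X Y)ρ` is a
tensor; in a local frame `sᵢ` its coefficients `H^ρ(sᵢ, sⱼ)` are continuous functions, and
`v = ∑ vⁱ sᵢ` with `vⁱ` continuous on the trivialising chart). [cite: ONeill1983, Ch. 3, Def. 3.48–Lemma 3.49] -/
theorem continuous_hessian_tangentBundle {ρ : M → ℝ} (hρ : ContMDiff I 𝓘(ℝ, ℝ) 2 ρ) :
    Continuous fun p : TangentBundle I M ↦ g.hessian ρ p.proj p.2 p.2 := by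
  classical
  have hLC : g.leviCivita.IsLocallyContMDiff 0 :=
    g.isLocallyContMDiff_leviCivita_holds 0 (by simpa using (Fact.out : (1 : ℕ∞ω) ≤ n))
  have hdρ := continuous_mvfderiv_tangentBundle (I := I) (M := M) hρ
  refine continuous_iff_continuousAt.2 fun p₀ ↦ ?_
  set x₀ := p₀.proj with hx₀
  set e := trivializationAt E (TangentSpace I : M → Type _) x₀ with he_def
  set b := Module.finBasis ℝ E with hb_def
  set ι := Fin (Module.finrank ℝ E)
  set s : ι → Π y : M, TangentSpace I y := e.localFrame b with hs_def
  have hx₀e : x₀ ∈ e.baseSet := FiberBundle.mem_baseSet_trivializationAt' x₀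
  -- the frame is smooth on the base set
  have hs : ∀ i, ∀ y ∈ e.baseSet, CMDiffAt ∞ (T% (s i)) y := fun i y hy ↦
    contMDiffAt_localFrame_of_mem ∞ e b i hy
  -- the coefficient functions `H i j y = Hess ρ (sᵢ, sⱼ)(y)` are continuous on the base set
  set Hc : ι → ι → M → ℝ := fun i j y ↦ g.hessian ρ y (s i y) (s j y) with hHc
  have hHc : ∀ i j, ContinuousOn (Hc i j) e.baseSet := by
    intro i j y hy
    -- `Hess ρ (sᵢ, sⱼ) = sᵢ (sⱼ ρ) - (∇_{sᵢ} sⱼ) ρ` near `y`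
    have heq : Hc i j =ᶠ[𝓝 y] fun z ↦ g.hessianAux ρ (s i) (s j) z := by
      filter_upwards [e.open_baseSet.mem_nhds hy] with z hz
      exact g.hessian_apply_holds (hρ.contMDiffAt) ((hs i z hz).mdifferentiableAt (by simp))
        ((hs j z hz).mdifferentiableAt (by simp))
    refine (ContinuousAt.congr ?_ heq.symm).continuousWithinAt
    -- first term: `z ↦ d(sⱼ ρ)_z (sᵢ z)` with `sⱼ ρ = dρ(sⱼ)` of class `C¹`
    have hF : CMDiffAt 1 (fun z ↦ mvfderiv I ρ z (s j z)) y :=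
      contMDiffAt_mvfderiv_apply (hρ.contMDiffAt) ((hs j y hy).of_le (by exact_mod_cast le_top))
    have h1 : CMDiffAt 0 (fun z ↦ mvfderiv I (fun z ↦ mvfderiv I ρ z (s j z)) z (s i z)) y :=
      VectorField.contMDiffAt_mvfderiv_apply_of_contMDiffAt hF
        ((hs i y hy).of_le (by exact_mod_cast le_top)) (by norm_num)
    -- second term: `z ↦ dρ_z (∇_{sᵢ} sⱼ z)` with `∇_{sᵢ} sⱼ` a continuous field near `y`
    have hsj : CMDiff[e.baseSet] ((0 : ℕ∞ω) + 1) (T% (s j)) := by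
      rw [zero_add]
      exact e.contMDiffOn_localFrame_baseSet 1 b j
    have hcov : CMDiff[e.baseSet] 0 (fun z ↦ TotalSpace.mk' (E →L[ℝ] E)
        (E := fun x : M ↦ TangentSpace I x →L[ℝ] TangentSpace I x) z (g.leviCivita (s j) z)) :=
      (hLC e.baseSet e.open_baseSet).contMDiff hsj
    have hZ : CMDiff[e.baseSet] 0 (T% (fun z ↦ g.leviCivita (s j) z (s i z))) :=
      hcov.clm_bundle_apply (e.contMDiffOn_localFrame_baseSet 0 b i)
    have h2 : ContinuousAt (fun z ↦ mvfderiv I ρ z (g.leviCivita (s j) z (s i z))) y := by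
      have hZc : ContinuousAt (T% (fun z ↦ g.leviCivita (s j) z (s i z))) y :=
        (hZ.continuousOn.continuousWithinAt hy).continuousAt (e.open_baseSet.mem_nhds hy)
      have h3 : ContinuousAt ((fun p : TangentBundle I M ↦ mvfderiv I ρ p.proj p.2) ∘
          (T% (fun z ↦ g.leviCivita (s j) z (s i z)))) y := hdρ.continuousAt.comp hZc
      exact h3
    exact (h1.continuousAt).sub h2
  -- coefficients of a vector in the frame, continuous on `e.source`
  set c : ι → TangentBundle I M → ℝ := fun i p ↦ b.coord i (e p).2 with hc_def
  have hcc : ∀ i, ContinuousOn (c i) e.source := fun i ↦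
    ((b.coord i).continuous_of_finiteDimensional.comp continuous_snd).comp_continuousOn
      e.continuousOn
  -- expansion of the quadratic form on `e.source`
  have hexp : ∀ p : TangentBundle I M, p ∈ e.source →
      g.hessian ρ p.proj p.2 p.2 = ∑ i, ∑ j, c i p * c j p * Hc j i p.proj := by
    intro p hp
    have hpe : p.proj ∈ e.baseSet := by rwa [e.mem_source] at hp
    have hv : p.2 = ∑ i, c i p • s i p.proj := by
      have h := e.eq_sum_localFrame_coeff_smul (I := I) (b := b) (s := fun _ ↦ p.2) hpe
      refine h.trans (Finset.sum_congr rfl fun i _ ↦ ?_)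
      rw [e.localFrame_coeff_eq_coeff (I := I) (b := b) (s := fun _ ↦ p.2) hpe]
      rfl
    conv_lhs => rw [hv]
    simp only [map_sum, map_smul, LinearMap.sum_apply, LinearMap.smul_apply, smul_eq_mul,
      Finset.mul_sum]
    refine Finset.sum_congr rfl fun i _ ↦ Finset.sum_congr rfl fun j _ ↦ ?_
    ring
  -- conclusion
  have hsrc : e.source ∈ 𝓝 p₀ := e.open_source.mem_nhds (by rw [e.mem_source]; exact hx₀e)
  have hsum : ContinuousOn (fun p : TangentBundle I M ↦ ∑ i, ∑ j, c i p * c j p * Hc j i p.proj)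
      e.source := by
    refine continuousOn_finsetSum _ fun i _ ↦ continuousOn_finsetSum _ fun j _ ↦ ?_
    refine ((hcc i).mul (hcc j)).mul ?_
    exact (hHc j i).comp (FiberBundle.continuous_proj E (TangentSpace I)).continuousOn
      fun p hp ↦ by rwa [e.mem_source] at hp
  have heq : (fun p : TangentBundle I M ↦ g.hessian ρ p.proj p.2 p.2) =ᶠ[𝓝 p₀]
      fun p ↦ ∑ i, ∑ j, c i p * c j p * Hc j i p.proj := by
    filter_upwards [hsrc] with p hp
    exact hexp p hp
  exact ((hsum.continuousWithinAt (mem_of_mem_nhds hsrc)).continuousAt hsrc).congr heq.symm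

/-! ### Strict convexity persists near the boundary (compactness) -/

section Convex

variable {g} [T2Space M] [CompactSpace M] {ρ : M → ℝ}

omit [CompleteSpace E] [Fact (1 ≤ n)] [g.HasLeviCivita] in
/-- The differential `dρ` is bounded on the unit sphere bundle of a compact manifold:
`|dρ_x(v)| ≤ C |v|_g` for all `(x, v)`. [folklore] -/
theorem exists_abs_mvfderiv_le_mul_sqrt (hg : g.IsRiemannian) (hρ : ContMDiff I 𝓘(ℝ, ℝ) 2 ρ) :
    ∃ C ≥ (0 : ℝ), ∀ (x : M) (v : TangentSpace I x),
      |mvfderiv I ρ x v| ≤ C * Real.sqrt (g.val x v v) := by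
  have hK := isCompact_unitTangent g hg (I := I) (M := M)
  have hdρ := continuous_mvfderiv_tangentBundle (I := I) (M := M) hρ
  obtain ⟨C, hC⟩ := hK.exists_bound_of_continuousOn (f := fun p : TangentBundle I M ↦
    mvfderiv I ρ p.proj p.2) hdρ.continuousOn
  refine ⟨max C 0, le_max_right _ _, fun x v ↦ ?_⟩
  by_cases hv : v = 0
  · subst hv
    simp
  have hpos : 0 < g.val x v v := hg x v hv
  set r := Real.sqrt (g.val x v v) with hr
  have hr0 : 0 < r := Real.sqrt_pos.2 hpos
  have hunit : g.val x (r⁻¹ • v) (r⁻¹ • v) = 1 := by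
    simp only [map_smul, FunLike.coe_smul, Pi.smul_apply, smul_eq_mul]
    rw [← Real.sq_sqrt hpos.le, ← hr]
    field_simp
  have h1 : ‖mvfderiv I ρ x (r⁻¹ • v)‖ ≤ C := hC ⟨x, r⁻¹ • v⟩ hunit
  have h2 : mvfderiv I ρ x (r⁻¹ • v) = r⁻¹ * mvfderiv I ρ x v := by
    rw [map_smul, smul_eq_mul]
  rw [h2, Real.norm_eq_abs, abs_mul, abs_of_pos (inv_pos.2 hr0), inv_mul_le_iff₀ hr0] at h1
  calc |mvfderiv I ρ x v| ≤ C * r := by linarith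
    _ ≤ max C 0 * r := by gcongr; exact le_max_left _ _

/-- **Strict convexity is an open condition along the boundary** (Paternain–Salo–Uhlmann 2023,
§3.1: positivity of the second fundamental form of `{ρ = 0}`; by compactness it persists on the
nearby level sets). For a strictly convex regular sublevel domain `{ρ ≤ 0}` of a smooth `ρ` on a
compact manifold there is `δ > 0` such that at every point `x` with `|ρ x| ≤ δ`: `dρ_x ≠ 0`, and
`Hess_x ρ (v, v) > 0` for all `v ≠ 0` with `dρ_x(v) = 0`. Proof: the set of `g`-unit tangent
vectors `v` with `|ρ| ≤ 1`, `dρ(v) = 0` and `Hess ρ(v,v) ≤ 0` is compact (the Hessian quadratic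
form is continuous on `TM`, `continuous_hessian_tangentBundle`) and `|ρ|` is positive on it; the
regular band is the tree's `exists_pos_forall_abs_le_mfderiv_ne_zero`.
[cite: PaternainSaloUhlmann2023, Def. 3.1.7 and Lemma 3.1.12] -/
theorem IsStrictlyConvexSublevel.exists_pos_forall_abs_le (hg : g.IsRiemannian)
    (hρ : ContMDiff I 𝓘(ℝ, ℝ) ∞ ρ) (h : IsStrictlyConvexSublevel g ρ) :
    ∃ δ > (0 : ℝ), ∀ x : M, |ρ x| ≤ δ →
      mfderiv I 𝓘(ℝ, ℝ) ρ x ≠ 0 ∧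
        ∀ v : TangentSpace I x, v ≠ 0 → mfderiv I 𝓘(ℝ, ℝ) ρ x v = 0 → 0 < g.hessian ρ x v v := by
  have hρ2 : ContMDiff I 𝓘(ℝ, ℝ) 2 ρ := hρ.of_le (by
    rw [show (2 : ℕ∞ω) = ((2 : ℕ∞) : ℕ∞ω) from rfl]; exact WithTop.coe_le_coe.2 le_top)
  -- the regular band
  obtain ⟨η, hη, hreg⟩ := Literature.Topology.FourManifolds.exists_pos_forall_abs_le_mfderiv_ne_zero
    hρ fun x hx ↦ h.mfderiv_ne_zero hx
  -- the bad set of unit vectors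
  have hdρ := continuous_mvfderiv_tangentBundle (I := I) (M := M) hρ2
  have hH := continuous_hessian_tangentBundle g hρ2
  have hρc : Continuous fun p : TangentBundle I M ↦ |ρ p.proj| :=
    (continuous_abs.comp hρ.continuous).comp (FiberBundle.continuous_proj E (TangentSpace I))
  set K : Set (TangentBundle I M) := {p | g.val p.proj p.2 p.2 = 1} ∩
    ({p | |ρ p.proj| ≤ 1} ∩ {p | mvfderiv I ρ p.proj p.2 = 0} ∩
      {p | g.hessian ρ p.proj p.2 p.2 ≤ 0}) with hK_def
  have hKc : IsCompact K := by
    refine (isCompact_unitTangent g hg).inter_right ?_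
    refine ((isClosed_le hρc continuous_const).inter (isClosed_eq hdρ continuous_const)).inter ?_
    exact isClosed_le hH continuous_const
  -- `|ρ|` is positive on `K`
  have hKpos : ∀ p ∈ K, 0 < |ρ p.proj| := by
    rintro ⟨x, v⟩ ⟨hunit, ⟨-, hd⟩, hHle⟩
    rw [abs_pos]
    intro hx0
    have hv : v ≠ 0 := by
      intro hv
      have h1 : g.val x v v = 1 := hunit
      rw [hv, map_zero] at h1
      simp at h1
    have hd' : mfderiv I 𝓘(ℝ, ℝ) ρ x v = 0 := hd
    have hpos := h.hessian_pos hx0 hv hd'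
    exact absurd hpos (not_lt.2 hHle)
  -- a positive lower bound `δ₁` of `|ρ|` on `K`
  obtain ⟨δ₁, hδ₁, hδ₁K⟩ : ∃ δ₁ > (0 : ℝ), ∀ p ∈ K, δ₁ ≤ |ρ p.proj| := by
    rcases K.eq_empty_or_nonempty with hKe | hKne
    · exact ⟨1, one_pos, fun p hp ↦ by rw [hKe] at hp; exact hp.elim⟩
    · obtain ⟨p₀, hp₀, hmin⟩ := hKc.exists_isMinOn hKne hρc.continuousOn
      exact ⟨|ρ p₀.proj|, hKpos p₀ hp₀, fun p hp ↦ hmin hp⟩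
  refine ⟨min (min (δ₁ / 2) η) 1, lt_min (lt_min (by positivity) hη) one_pos, fun x hx ↦ ⟨?_, ?_⟩⟩
  · refine hreg x (le_trans hx (le_trans (min_le_left _ _) (le_trans (min_le_right _ _) ?_)))
    linarith
  · intro v hv hdv
    have hx1 : |ρ x| < δ₁ :=
      lt_of_le_of_lt hx (lt_of_le_of_lt (le_trans (min_le_left _ _) (min_le_left _ _)) (by linarith))
    have hx2 : |ρ x| ≤ 1 := le_trans hx (min_le_right _ _)
    -- normalise `v`
    have hpos : 0 < g.val x v v := hg x v hv
    set r := Real.sqrt (g.val x v v) with hr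
    have hr0 : 0 < r := Real.sqrt_pos.2 hpos
    have hunit : g.val x (r⁻¹ • v) (r⁻¹ • v) = 1 := by
      simp only [map_smul, FunLike.coe_smul, Pi.smul_apply, smul_eq_mul]
      rw [← Real.sq_sqrt hpos.le, ← hr]
      field_simp
    by_contra hle
    push Not at hle
    have hHu : g.hessian ρ x (r⁻¹ • v) (r⁻¹ • v) ≤ 0 := by
      simp only [map_smul, LinearMap.smul_apply, smul_eq_mul]
      have : r⁻¹ * (r⁻¹ * g.hessian ρ x v v) = r⁻¹ ^ 2 * g.hessian ρ x v v := by ring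
      rw [this]
      exact mul_nonpos_of_nonneg_of_nonpos (sq_nonneg _) hle
    have hdu : mvfderiv I ρ x (r⁻¹ • v) = 0 := by
      rw [map_smul]
      have hdv' : mvfderiv I ρ x v = 0 := hdv
      rw [hdv', smul_zero]
    have hmem : (⟨x, r⁻¹ • v⟩ : TangentBundle I M) ∈ K := ⟨hunit, ⟨hx2, hdu⟩, hHu⟩
    exact absurd (hδ₁K _ hmem) (not_le.2 hx1)

/-- **Short geodesic segments with endpoints in a strictly convex domain stay in the domain**
(the local geodesic convexity of a domain with strictly convex boundary; Paternain–Salo–Uhlmann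
2023, Lemma 3.1.12 / proof of Prop. 3.7.21-type arguments: a geodesic touching a level set
`{ρ = c}`, `|c|` small, from inside at an interior maximum of `ρ ∘ γ` would have
`(ρ ∘ γ)'' = Hess ρ(γ', γ') > 0` there). On a compact manifold, for a smooth `ρ` with `{ρ ≤ 0}` a
strictly convex regular sublevel domain, there is `ℓ₀ > 0` such that every geodesic `γ` of speed
`|γ'|_g < ℓ₀` satisfies: if `ρ(γ 0) ≤ 0` and `ρ(γ 1) ≤ 0` then `ρ(γ t) ≤ 0` on `[0, 1]`, and if
`ρ(γ 0) < 0` and `ρ(γ 1) < 0` then `ρ(γ t) < 0` on `[0, 1]`. Proof: `|(ρ ∘ γ)'| ≤ C |γ'|_g`, so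
along `[0,1]` the values of `ρ ∘ γ` stay below `ρ(γ 0) + C ℓ₀ < δ` with `δ` from
`IsStrictlyConvexSublevel.exists_pos_forall_abs_le`; at an interior maximum `t*` with
`ρ(γ t*) ≥ 0`, `dρ(γ' t*) = 0` (Fermat) and `Hess ρ(γ' t*, γ' t*) > 0`, so `t*` is a strict local
minimum of `ρ ∘ γ` (`eventually_lt_of_hasDerivAt_deriv_pos`), a contradiction.
[cite: PaternainSaloUhlmann2023, Lemma 3.1.12] -/
theorem IsStrictlyConvexSublevel.exists_pos_forall_isGeodesic (hg : g.IsRiemannian)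
    (hρ : ContMDiff I 𝓘(ℝ, ℝ) ∞ ρ) (h : IsStrictlyConvexSublevel g ρ) :
    ∃ ℓ₀ > (0 : ℝ), ∀ γ : ℝ → M, IsGeodesic g.leviCivita γ →
      g.val (γ 0) (velocity I γ 0) (velocity I γ 0) < ℓ₀ ^ 2 →
      (ρ (γ 0) ≤ 0 → ρ (γ 1) ≤ 0 → ∀ t ∈ Icc (0 : ℝ) 1, ρ (γ t) ≤ 0) ∧
      (ρ (γ 0) < 0 → ρ (γ 1) < 0 → ∀ t ∈ Icc (0 : ℝ) 1, ρ (γ t) < 0) := by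
  have hρ2 : ContMDiff I 𝓘(ℝ, ℝ) 2 ρ := hρ.of_le (by
    rw [show (2 : ℕ∞ω) = ((2 : ℕ∞) : ℕ∞ω) from rfl]; exact WithTop.coe_le_coe.2 le_top)
  obtain ⟨C, hC0, hC⟩ := exists_abs_mvfderiv_le_mul_sqrt (g := g) hg hρ2
  obtain ⟨δ, hδ, hconv⟩ := h.exists_pos_forall_abs_le hg hρ
  refine ⟨δ / (C + 1), by positivity, fun γ hγ hspeed ↦ ?_⟩
  -- notation and the speed
  have hnn : ∀ (x : M) (v : TangentSpace I x), 0 ≤ g.val x v v := fun x v ↦ by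
    by_cases hv : v = 0
    · rw [hv]; simp
    · exact (hg x v hv).le
  set σ : ℝ := Real.sqrt (g.val (γ 0) (velocity I γ 0) (velocity I γ 0)) with hσ_def
  have hσ0 : 0 ≤ σ := Real.sqrt_nonneg _
  have hσ : σ < δ / (C + 1) := by
    rw [hσ_def, Real.sqrt_lt' (by positivity)]
    exact hspeed
  have hCσ : C * σ < δ := by
    have h1 : C * σ ≤ C * (δ / (C + 1)) := mul_le_mul_of_nonneg_left hσ.le hC0
    have h2 : C * (δ / (C + 1)) < δ := by
      rw [mul_div_assoc', div_lt_iff₀ (by positivity)]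
      nlinarith
    linarith
  set u : ℝ → ℝ := fun t ↦ ρ (γ t) with hu_def
  set u' : ℝ → ℝ := fun t ↦ mvfderiv I ρ (γ t) (velocity I γ t) with hu'_def
  have hderiv : ∀ t, HasDerivAt u (u' t) t := fun t ↦
    hasDerivAt_comp_curve_mvfderiv ((hρ2.contMDiffAt).mdifferentiableAt two_ne_zero)
      (IsGeodesicOn.mdifferentiableAt_holds hγ (mem_univ t))
  have hspeed_eq : ∀ t, Real.sqrt (g.val (γ t) (velocity I γ t) (velocity I γ t)) = σ := fun t ↦ by
    rw [hσ_def, hγ.val_velocity_eq g t 0]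
  have hbound : ∀ t, |u' t| ≤ C * σ := fun t ↦ by
    have h1 := hC (γ t) (velocity I γ t)
    rwa [hspeed_eq t] at h1
  -- `ρ (γ t) ≤ ρ (γ 0) + C σ t` on `[0, 1]`
  have hlip : ∀ t ∈ Icc (0 : ℝ) 1, u t ≤ u 0 + C * σ := by
    intro t ht
    have h1 := norm_image_sub_le_of_norm_deriv_le_segment' (f := u) (f' := u') (a := 0) (b := 1)
      (fun s _ ↦ (hderiv s).hasDerivWithinAt) (fun s _ ↦ by rw [Real.norm_eq_abs]; exact hbound s)
      t ht
    rw [Real.norm_eq_abs, sub_zero] at h1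
    have h2 : u t - u 0 ≤ C * σ * t := le_trans (le_abs_self _) h1
    have h3 : C * σ * t ≤ C * σ := by
      have : 0 ≤ C * σ := mul_nonneg hC0 hσ0
      nlinarith [ht.1, ht.2]
    linarith
  have hcont : Continuous u := continuous_iff_continuousAt.2 fun t ↦ (hderiv t).continuousAt
  -- the key step: no interior maximum with nonnegative value
  have key : ∀ t₀ ∈ Icc (0 : ℝ) 1, IsMaxOn u (Icc 0 1) t₀ → u 0 ≤ 0 → u 0 < u t₀ → u 1 < u t₀ →
      0 ≤ u t₀ → False := by
    intro t₀ ht₀ hmax hu0 h0lt h1lt hnonneg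
    -- `t₀` is interior
    have ht₀0 : 0 < t₀ := lt_of_le_of_ne ht₀.1 fun h0 ↦ by rw [← h0] at h0lt; exact lt_irrefl _ h0lt
    have ht₀1 : t₀ < 1 := lt_of_le_of_ne ht₀.2 fun h1 ↦ by rw [h1] at h1lt; exact lt_irrefl _ h1lt
    have hnhds : Icc (0 : ℝ) 1 ∈ 𝓝 t₀ := Icc_mem_nhds ht₀0 ht₀1
    -- `|ρ (γ t₀)| ≤ δ`
    have habs : |ρ (γ t₀)| ≤ δ := by
      rw [abs_of_nonneg hnonneg]
      have := hlip t₀ ht₀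
      show u t₀ ≤ δ
      linarith
    -- Fermat
    have hloc : IsLocalMax u t₀ := hmax.isLocalMax hnhds
    have hd0 : u' t₀ = 0 := hloc.hasDerivAt_eq_zero (hderiv t₀)
    -- the velocity does not vanish
    have hv : velocity I γ t₀ ≠ 0 := by
      intro hv
      have hσz : σ = 0 := by
        rw [← hspeed_eq t₀, hv, map_zero]
        simp
      have h1 := hlip t₀ ht₀
      rw [hσz, mul_zero, add_zero] at h1
      exact absurd h0lt (not_lt.2 h1)
    -- strict convexity at `γ t₀`
    have hd0' : mfderiv I 𝓘(ℝ, ℝ) ρ (γ t₀) (velocity I γ t₀) = 0 := hd0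
    have hH : 0 < g.hessian ρ (γ t₀) (velocity I γ t₀) (velocity I γ t₀) :=
      (hconv (γ t₀) habs).2 _ hv hd0'
    -- second derivative test: `t₀` is a strict local minimum of `u`
    have hu2 := g.hasDerivAt_mvfderiv_velocity_of_isGeodesicOn hγ (mem_univ t₀) (hρ2.contMDiffAt)
    have hev := eventually_lt_of_hasDerivAt_deriv_pos (Eventually.of_forall hderiv) hu2 hd0 hH
    have hev2 : ∀ᶠ t in 𝓝[≠] t₀, t ∈ Icc (0 : ℝ) 1 := mem_nhdsWithin_of_mem_nhds hnhds
    obtain ⟨t, ht, htI⟩ := (hev.and hev2).exists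
    exact absurd (hmax htI) (not_le.2 ht)
  -- the maximum of `u` on `[0, 1]`
  obtain ⟨t₀, ht₀, hmax⟩ := isCompact_Icc.exists_isMaxOn (nonempty_Icc.2 zero_le_one) hcont.continuousOn
  refine ⟨fun h0 h1 t ht ↦ ?_, fun h0 h1 t ht ↦ ?_⟩
  · by_contra hpos
    push Not at hpos
    have hle : u t ≤ u t₀ := hmax ht
    exact key t₀ ht₀ hmax h0 (by show u 0 < u t₀; linarith [show u t = ρ (γ t) from rfl])
      (by show u 1 < u t₀; linarith [show u t = ρ (γ t) from rfl]) (by show 0 ≤ u t₀; linarith)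
  · by_contra hpos
    push Not at hpos
    have hle : u t ≤ u t₀ := hmax ht
    exact key t₀ ht₀ hmax h0.le (by show u 0 < u t₀; linarith [show u t = ρ (γ t) from rfl])
      (by show u 1 < u t₀; linarith [show u t = ρ (γ t) from rfl]) (by show 0 ≤ u t₀; linarith)

end Convex

end Literature.Geometry.Riemannian
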